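import Literature.Topology.PlanarFoliations.Kneser
import Literature.Topology.PlaneTopology.JordanFill
import HarnessLib

/-!
# The disc of a compact leaf as the fill of a Jordan loop

Topic: Topology / PlanarFoliations, sequel to `Kneser.lean` (`insideLeaf`, `discLeaf` of a compact
leaf) and `PlaneTopology/JordanFill.lean`. The image of a compact leaf `K` is the curve of a
Jordan loop (its injective leaf loop read in the plane), whose inside is `insideLeaf` and whose
fill is `discLeaf` (`exists_isJordanLoop_leaf`). This lets compact leaves and separatrix
polygons be compared by the weak nesting lemmas of `JordanFill.lean`
(`discLeaf_subset_fill_of_image_subset_fill`, `fill_subset_discLeaf_of_range_subset_discLeaf`).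

All statements are [folklore].
-/

noncomputable section

open Set Function
open _root_.Topology
open Literature.Topology.FourManifolds Literature.Topology.FourManifolds.Foliation Literature.Topology.PlaneTopology

namespace Literature.Topology.PlanarFoliations

variable {X : Type*} [TopologicalSpace X] [T2Space X] [SecondCountableTopology X] {F : Foliation ℝ X} {ι : X → ℂ}

/-- **A compact leaf is the curve of a Jordan loop, with inside `insideLeaf` and fill `discLeaf`.**
[folklore] -/
theorem exists_isJordanLoop_leaf (hbi : IsBiOriented F) (hι : IsOpenEmbedding ι) {y : X} (hK : IsCompact (F.leaf y)) :
    ∃ γ : ℝ → ℂ, IsJordanLoop γ ∧ range γ = ι '' F.leaf y ∧ IsJordanLoop.inside γ = insideLeaf F ι y ∧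
      IsJordanLoop.fill γ = discLeaf F ι y := by
  obtain ⟨β, hc, hp, hinj, hsurj⟩ := exists_leafLoop_of_isCompact (x := y) hbi hK
  set γ : ℝ → ℂ := fun s ↦ ι (Leaf.pt (β s)) with hγ
  have hγc : Continuous γ := hι.continuous.comp ((Leaf.continuous_coe F y).comp hc)
  have hγp : Periodic γ 1 := fun s ↦ by show ι (Leaf.pt (β (s + 1))) = _; rw [hp s]
  have hγinj : InjOn γ (Ico 0 1) := fun s hs t ht hst ↦ hinj hs ht (Leaf.injective_coe F y (hι.injective hst))
  have hrange : range γ = ι '' F.leaf y := by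
    rw [image_leaf_eq_range, hγ]
    ext z
    constructor
    · rintro ⟨s, rfl⟩; exact ⟨β s, rfl⟩
    · rintro ⟨q, rfl⟩
      obtain ⟨s, rfl⟩ : q ∈ range β := by rw [hsurj]; exact mem_univ q
      exact ⟨s, rfl⟩
  have hJ : IsJordanLoop γ := ⟨hγc, hγp, hγinj⟩
  have hin : IsJordanLoop.inside γ = insideLeaf F ι y := by
    ext z; simp only [IsJordanLoop.inside, insideLeaf, hrange, mem_setOf_eq]
  refine ⟨γ, hJ, hrange, hin, ?_⟩
  rw [IsJordanLoop.fill, hrange, hin, discLeaf]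

/-- **The disc of a compact leaf whose image lies in the fill of a Jordan loop lies in that fill.**
[folklore] -/
theorem discLeaf_subset_fill_of_image_subset_fill (hbi : IsBiOriented F) (hι : IsOpenEmbedding ι) {y : X}
    (hK : IsCompact (F.leaf y)) {A : ℝ → ℂ} (hA : IsJordanLoop A) (h : ι '' F.leaf y ⊆ IsJordanLoop.fill A) :
    discLeaf F ι y ⊆ IsJordanLoop.fill A := by
  obtain ⟨γ, -, hr, -, hfill⟩ := exists_isJordanLoop_leaf hbi hι hK
  rw [← hfill]
  exact hA.fill_subset_fill_of_range_subset_fill (by rw [hr]; exact h)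

/-- **The fill of a loop running in the disc of a compact leaf lies in that disc.** [folklore] -/
theorem fill_subset_discLeaf_of_range_subset_discLeaf (hbi : IsBiOriented F) (hι : IsOpenEmbedding ι) {y : X}
    (hK : IsCompact (F.leaf y)) {C : ℝ → ℂ} (h : range C ⊆ discLeaf F ι y) : IsJordanLoop.fill C ⊆ discLeaf F ι y := by
  obtain ⟨γ, hJ, -, -, hfill⟩ := exists_isJordanLoop_leaf hbi hι hK
  rw [← hfill] at h ⊢
  exact hJ.fill_subset_fill_of_range_subset_fill h

/-- **The discs of two compact leaves, one with image in the other's disc, are nested.**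
[folklore] -/
theorem discLeaf_subset_discLeaf_of_image_subset (hbi : IsBiOriented F) (hι : IsOpenEmbedding ι) {y w : X}
    (hK : IsCompact (F.leaf y)) (hK' : IsCompact (F.leaf w)) (h : ι '' F.leaf w ⊆ discLeaf F ι y) :
    discLeaf F ι w ⊆ discLeaf F ι y := by
  obtain ⟨γ, hJ, -, -, hfill⟩ := exists_isJordanLoop_leaf hbi hι hK
  rw [← hfill] at h ⊢
  exact discLeaf_subset_fill_of_image_subset_fill hbi hι hK' hJ h

/-- **The frontier of the disc of a compact leaf is the leaf.** [folklore] -/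
theorem frontier_discLeaf (hbi : IsBiOriented F) (hι : IsOpenEmbedding ι) {y : X} (hK : IsCompact (F.leaf y)) :
    frontier (discLeaf F ι y) = ι '' F.leaf y := by
  obtain ⟨γ, hJ, hr, -, hfill⟩ := exists_isJordanLoop_leaf hbi hι hK
  rw [← hfill, hJ.frontier_fill, hr]

/-- **The interior of the disc of a compact leaf is its inner domain.** [folklore] -/
theorem interior_discLeaf (hbi : IsBiOriented F) (hι : IsOpenEmbedding ι) {y : X} (hK : IsCompact (F.leaf y)) :
    interior (discLeaf F ι y) = insideLeaf F ι y := by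
  obtain ⟨γ, hJ, -, hin, hfill⟩ := exists_isJordanLoop_leaf hbi hι hK
  rw [← hfill, hJ.interior_fill, hin]

end Literature.Topology.PlanarFoliations
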